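import Summits.CriticalPhenomena.PercolationContinuityZ3.Theorems.PercNearOneGluingNoHeavyQuantLongTailQuadHubRoute
import Summits.CriticalPhenomena.PercolationContinuityZ3.Theorems.PercNearOneGluingNoHeavyQuantShapeHubWide
import Summits.CriticalPhenomena.PercolationContinuityZ3.Theorems.PercNearOneGluingNoHeavyQuantElemSymmBound
import HarnessLib

/-!
# QUANT lane R8, T-DEC: THE LONG-TAIL QUAD HUB — the width-4 sub-floor hub `S(γ₁) ∗ S(γ₂) ∗ S(γ₃) ∗ S(γ₄)` of EVERY shape `{lo, lo+K; γ}` with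
# `2lo < K ≤ 4lo` is SDEC at EVERY gate `γᵢ ≥ lo/K` and every affordable floor; hence the hubs of widths 2, 3, 4 of every shape `lo < K ≤ 4lo`
# (census-1 gen 35)

builds on p205010 (kernel theorem, internal audit signed; external expert review pending)

Support file (`--supports stmt-CriticalPhenomena-4575`), QUANT lane seat prim-quant-census-1 (gen 35); memo
`run/shared/lean/prim/quant/prim-quant-census-1/g35/QUADHUB-G35.md`.  Theorems only, standard axioms, no sorries.  Uses arm-1 g50's torque-cost
criterion `decAt_all_of_torqueCost` / g49's `decAt_all_of_lowCeiling`, g31's `lconv_sp_apply` / `sHub_laws` / `sHub_struct` / `sHub_mass_esL`, and this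
generation's routes `quadHub_routeOne` (one low) and `quadHub_routeTwo` (two lows).  The width-4 successor of gen 32/33's `sdec_sHub_three_all` /
`sdec_sHub_three_wide4` (gen 34 FOREST3-G34 §4 item 1: the kernel coverage of glued-sibling forests stops at ≤ 3 tight siblings of one long-tail shape
exactly for want of this hub).

THE LAW `sHub lo K [γ₁, γ₂, γ₃, γ₄]` lives on `{4lo + sK}` with the Poisson-binomial masses `u₀..u₄`, mean `T₀ = 4lo + KΣγᵢ`; at the outer gate `a`
(`T = aT₀`, `y = ax`) the positive lows are `4lo` (iff `T > 8lo`) and `4lo+K` (iff `T > 8lo+2K`).  THE RULE (memo §1): `4lo → 4lo+2K` for `T < 8lo+K`,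
`4lo → 4lo+3K` for `8lo+K ≤ T`, `4lo+K → 4lo+2K` when it is a low — unsplit reflected routes, every far route cost-safe; the six capacities are the
closed forms of `…QuantLongTailQuadHubAlg` (by hand; the tight one is `quadHub_coreE`, margin `∝ 1/2 − lo/K`) and `…QuantLongTailQuadHubCert`.
* **`sdec_sHub_four_long`** — `2lo < K ≤ 4lo`; `P = [γ₁, γ₂, γ₃, γ₄]` with `lo ≤ Kγᵢ`, `γᵢ < 1`, `x(lo+K) ≤ lo+Kγᵢ`; `0 < x` ⟹
  **`SDEC x ((lo+K)·4) (sHub lo K P)`**; **`sdec_sHub_four_upTo4`** — with gen 32's `sdec_sHub_wide` (`K ≤ 2lo`): every `lo < K ≤ 4lo`;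
  **`sdec_sHub_upToFour_upTo4`** — widths 2, 3 AND 4 of every shape `lo < K ≤ 4lo` at every gate (with gen 33's `sdec_sHub_twoThree_upTo4`).
NUMERICS (memo §1, `g35/code/exp2_quad_rule.py`, exact rationals, 23 shapes `2 ≤ K/lo ≤ 4`, gates down to `lo/K`, three floors, 16–24 outer gates):
1 105 104 (hub, floor, gate) instances (461 895 with a positive low, 298 191 far routes), 0 failures of compatibility / capacity / cost-safety; least
relative slack `3·10⁻⁵` (`4lo+K → 4lo+2K`, floor part, `lo/K = 20/41`, gates `127/128`).  gen 34 kit j305760: hub numerically SDEC at widths 4–6.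

HONEST STATUS.  A core lemma (width 4); with it gen 31/32's piece expansion `shapeForest_inv` runs on `|P|+|L| ≤ 4`, i.e. forests with ≤ 4 tight glued
siblings of one shape `lo < K ≤ 4lo` (next file).  Widths `≥ 5` for `K > 2lo`, shapes `K > 4lo`, mixed-shape hubs remain; `SiblingStep`,
`GluedDominatedMass`, `SDECConvClosed`, `FarTreeRow` OPEN; RATE class (log\*) / honest sentence of `run/shared/lean/prim/quant/README.md` unchanged.
[this work].  Nothing here is cited as a published result.  The gluing rows served [cite: KozmaNitzan2024, Conjecture 3 (p. 15)]; product measure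
[cite: Grimmett1999, §1.3 p. 10].
-/

noncomputable section
open scoped BigOperators

namespace Summit.CriticalPhenomena.PercolationContinuityZ3.Theorems
namespace Quant
namespace LawDec

/-- the FAR-GIANT PIECE of shape `(lo, K)`: `S(γ) = {lo: 1−γ, lo+K: γ}` -/
local notation3 "SP[" lo ", " K ", " a "]" => (fun h : ℕ => (1 - (a : ℝ)) * (if h = (lo : ℕ) then (1 : ℝ) else 0) +
  (a : ℝ) * (if h = (lo : ℕ) + (K : ℕ) then (1 : ℝ) else 0))

/-! ### The long-tail quad hub is SDEC -/

set_option maxHeartbeats 1600000 in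
/-- **THE LONG-TAIL QUAD HUB IS SDEC, `2lo < K ≤ 4lo`.**  Four gates `P = [γ₁, γ₂, γ₃, γ₄]` with `lo ≤ Kγᵢ`, `γᵢ < 1`, `x(lo+K) ≤ lo + Kγᵢ`,
and every floor `0 < x`: `SDEC x ((lo+K)·|P|) (sHub lo K P)`.  At each outer gate `a` (`T = a(4lo + KΣγᵢ)`, `y = ax`): no low for `T ≤ 8lo`;
ONE low `4lo` for `8lo < T ≤ 8lo+2K`, shipped whole to `4lo+2K` (`T < 8lo+K`) or `4lo+3K` (cost-safe far routes, `quadHub_routeOne`); TWO lows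
`4lo → 4lo+3K`, `4lo+K → 4lo+2K` for `T > 8lo+2K` (both near, `quadHub_routeTwo`); then arm-1's torque-cost criterion. [this work] -/
theorem sdec_sHub_four_long (lo K : ℕ) (hloK : lo < K) (hK2 : 2 * lo < K) (hK8 : K ≤ 4 * lo) {x : ℝ} (hx0 : 0 < x) (P : List ℝ)
    (hP4 : P.length = 4) (hP : ∀ γ ∈ P, (lo : ℝ) ≤ K * γ ∧ γ < 1 ∧ x * ((lo : ℝ) + K) ≤ lo + K * γ) :
    SDEC x ((lo + K) * P.length) (sHub lo K P) := by
  obtain ⟨γ₁, γ₂, γ₃, γ₄, rfl⟩ : ∃ a b c d, P = [a, b, c, d] := by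
    match P, hP4 with
    | [a, b, c, d], _ => exact ⟨a, b, c, d, rfl⟩
  obtain ⟨hγ₁, hγ₁1, hx₁⟩ := hP γ₁ (by simp)
  obtain ⟨hγ₂, hγ₂1, hx₂⟩ := hP γ₂ (by simp)
  obtain ⟨hγ₃, hγ₃1, hx₃⟩ := hP γ₃ (by simp)
  obtain ⟨hγ₄, hγ₄1, hx₄⟩ := hP γ₄ (by simp)
  have hlo1 : 1 ≤ lo := by omega
  have hloR : (1 : ℝ) ≤ lo := by exact_mod_cast hlo1
  have hKR : (lo : ℝ) < K := by exact_mod_cast hloK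
  have hK4R : (K : ℝ) ≤ 4 * lo := by exact_mod_cast hK8
  have hK0 : (0 : ℝ) < K := by linarith
  have hγ₁0 : 0 ≤ γ₁ := by
    by_contra hc; push Not at hc; have := mul_neg_of_pos_of_neg hK0 hc; linarith
  have hγ₂0 : 0 ≤ γ₂ := by
    by_contra hc; push Not at hc; have := mul_neg_of_pos_of_neg hK0 hc; linarith
  have hγ₃0 : 0 ≤ γ₃ := by
    by_contra hc; push Not at hc; have := mul_neg_of_pos_of_neg hK0 hc; linarith
  have hγ₄0 : 0 ≤ γ₄ := by
    by_contra hc; push Not at hc; have := mul_neg_of_pos_of_neg hK0 hc; linarith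
  have hx1 : x < 1 := by
    have : (lo : ℝ) + K * γ₁ < lo + K := by have := mul_lt_mul_of_pos_left hγ₁1 hK0; linarith
    by_contra hc; push Not at hc
    have : 1 * ((lo : ℝ) + K) ≤ x * (lo + K) := mul_le_mul_of_nonneg_right hc (by linarith)
    linarith
  -- the pair hub `L₂ = sHub lo K [γ₃, γ₄]`
  have hP01₂ : ∀ γ ∈ [γ₃, γ₄], 0 ≤ γ ∧ γ ≤ 1 := by
    intro γ hγ; simp only [List.mem_cons, List.mem_nil_iff, or_false] at hγ
    rcases hγ with rfl | rfl; exacts [⟨hγ₃0, hγ₃1.le⟩, ⟨hγ₄0, hγ₄1.le⟩]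
  obtain ⟨_, mM, _, _⟩ := sHub_laws lo K [γ₃, γ₄] hP01₂
  have elen₂ : (lo + K) * ([γ₃, γ₄] : List ℝ).length = (lo + K) * 2 := rfl
  set L₂ : ℕ → ℝ := sHub lo K [γ₃, γ₄] with hL₂
  have cM : ∀ i, (lo + K) * 1 < i → SP[lo, K, γ₄] i = 0 := fun i hi => (sp_laws lo K hγ₄0 hγ₄1.le).2.1 i (by omega)
  have hS4 : sHub lo K [γ₄] = SP[lo, K, γ₄] := funext fun k => lconv_delta_left _ (lo + K) _ (sp_laws lo K hγ₄0 hγ₄1.le).2.1 k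
  have hdef₂ : L₂ = lconv ((lo + K) * 1) (lo + K) SP[lo, K, γ₄] SP[lo, K, γ₃] := by
    rw [hL₂]; show lconv _ _ (sHub lo K [γ₄]) _ = _; rw [hS4]; rfl
  have Lv₂ : ∀ k, L₂ k = (1 - γ₃) * (if lo ≤ k then SP[lo, K, γ₄] (k - lo) else 0) + γ₃ * (if lo + K ≤ k then SP[lo, K, γ₄] (k - (lo + K)) else 0) :=
    fun k => by rw [hdef₂]; exact lconv_sp_apply lo K ((lo + K) * 1) SP[lo, K, γ₄] γ₃ cM k
  have wlo : L₂ (2 * lo) = (1 - γ₃) * (1 - γ₄) := by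
    rw [Lv₂, if_pos (by omega), if_neg (by omega), show 2 * lo - lo = lo by omega]
    dsimp only; rw [if_pos rfl, if_neg (by omega)]; ring
  have wmid : L₂ (2 * lo + K) = γ₃ * (1 - γ₄) + γ₄ * (1 - γ₃) := by
    rw [Lv₂, if_pos (by omega), if_pos (by omega), show 2 * lo + K - lo = lo + K by omega, show 2 * lo + K - (lo + K) = lo by omega]
    dsimp only; rw [if_neg (by omega), if_pos rfl, if_pos rfl, if_neg (by omega)]; ring
  have wtop : L₂ (2 * lo + 2 * K) = γ₃ * γ₄ := by
    rw [Lv₂, if_pos (by omega), if_pos (by omega), show 2 * lo + 2 * K - lo = lo + 2 * K by omega,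
      show 2 * lo + 2 * K - (lo + K) = lo + K by omega]
    dsimp only; rw [if_neg (by omega), if_neg (by omega), if_neg (by omega), if_pos rfl]; ring
  have mM₂ : ∀ i, (lo + K) * 2 < i → L₂ i = 0 := fun i hi => mM i (by rw [elen₂]; exact hi)
  -- the triple hub `L₃ = L₂ ∗ S(γ₂)`
  have hP01₃ : ∀ γ ∈ [γ₂, γ₃, γ₄], 0 ≤ γ ∧ γ ≤ 1 := by
    intro γ hγ; simp only [List.mem_cons, List.mem_nil_iff, or_false] at hγ
    rcases hγ with rfl | rfl | rfl; exacts [⟨hγ₂0, hγ₂1.le⟩, ⟨hγ₃0, hγ₃1.le⟩, ⟨hγ₄0, hγ₄1.le⟩]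
  obtain ⟨_, kM, _, _⟩ := sHub_laws lo K [γ₂, γ₃, γ₄] hP01₃
  have elen₃ : (lo + K) * ([γ₂, γ₃, γ₄] : List ℝ).length = (lo + K) * 3 := rfl
  set L₃ : ℕ → ℝ := sHub lo K [γ₂, γ₃, γ₄] with hL₃
  have hdef₃ : L₃ = lconv ((lo + K) * 2) (lo + K) L₂ SP[lo, K, γ₂] := by rw [hL₃, hL₂]; rfl
  have Lv₃ : ∀ k, L₃ k = (1 - γ₂) * (if lo ≤ k then L₂ (k - lo) else 0) + γ₂ * (if lo + K ≤ k then L₂ (k - (lo + K)) else 0) :=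
    fun k => by rw [hdef₃]; exact lconv_sp_apply lo K ((lo + K) * 2) L₂ γ₂ mM₂ k
  have vlo : L₃ (3 * lo) = (1 - γ₂) * ((1 - γ₃) * (1 - γ₄)) := by
    rw [Lv₃, if_pos (by omega), if_neg (by omega), show 3 * lo - lo = 2 * lo by omega, wlo]; ring
  have vmid : L₃ (3 * lo + K) = (1 - γ₂) * (γ₃ * (1 - γ₄) + γ₄ * (1 - γ₃)) + γ₂ * ((1 - γ₃) * (1 - γ₄)) := by
    rw [Lv₃, if_pos (by omega), if_pos (by omega), show 3 * lo + K - lo = 2 * lo + K by omega, show 3 * lo + K - (lo + K) = 2 * lo by omega,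
      wmid, wlo]
  have vtop : L₃ (3 * lo + 2 * K) = (1 - γ₂) * (γ₃ * γ₄) + γ₂ * (γ₃ * (1 - γ₄) + γ₄ * (1 - γ₃)) := by
    rw [Lv₃, if_pos (by omega), if_pos (by omega), show 3 * lo + 2 * K - lo = 2 * lo + 2 * K by omega,
      show 3 * lo + 2 * K - (lo + K) = 2 * lo + K by omega, wtop, wmid]
  have vmax : L₃ (3 * lo + 3 * K) = γ₂ * (γ₃ * γ₄) := by
    rw [Lv₃, if_pos (by omega), if_pos (by omega), show 3 * lo + 3 * K - (lo + K) = 2 * lo + 2 * K by omega, wtop,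
      mM₂ (3 * lo + 3 * K - lo) (by omega)]; ring
  have mM₃ : ∀ i, (lo + K) * 3 < i → L₃ i = 0 := fun i hi => kM i (by rw [elen₃]; exact hi)
  -- the quad hub `L = L₃ ∗ S(γ₁)`
  have hP01 : ∀ γ ∈ [γ₁, γ₂, γ₃, γ₄], 0 ≤ γ ∧ γ ≤ 1 := by
    intro γ hγ; simp only [List.mem_cons, List.mem_nil_iff, or_false] at hγ
    rcases hγ with rfl | rfl | rfl | rfl; exacts [⟨hγ₁0, hγ₁1.le⟩, ⟨hγ₂0, hγ₂1.le⟩, ⟨hγ₃0, hγ₃1.le⟩, ⟨hγ₄0, hγ₄1.le⟩]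
  have hP01' : ∀ γ ∈ [γ₁, γ₂, γ₃, γ₄], 0 ≤ γ ∧ γ < 1 := by
    intro γ hγ; simp only [List.mem_cons, List.mem_nil_iff, or_false] at hγ
    rcases hγ with rfl | rfl | rfl | rfl; exacts [⟨hγ₁0, hγ₁1⟩, ⟨hγ₂0, hγ₂1⟩, ⟨hγ₃0, hγ₃1⟩, ⟨hγ₄0, hγ₄1⟩]
  obtain ⟨l0, lM, l1, lmean⟩ := sHub_laws lo K [γ₁, γ₂, γ₃, γ₄] hP01
  have eT0 : (([γ₁, γ₂, γ₃, γ₄] : List ℝ).map (fun γ => (lo : ℝ) + K * γ)).sum = 4 * (lo : ℝ) + K * (γ₁ + γ₂ + γ₃ + γ₄) := by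
    simp only [List.map_cons, List.map_nil, List.sum_cons, List.sum_nil]; ring
  rw [eT0] at lmean
  have elen : (lo + K) * ([γ₁, γ₂, γ₃, γ₄] : List ℝ).length = 4 * lo + 4 * K := by show (lo + K) * 4 = 4 * lo + 4 * K; ring
  -- the bottom atom by the elementary-symmetric formula (no subtraction bookkeeping)
  have z0' : sHub lo K [γ₁, γ₂, γ₃, γ₄] (4 * lo) = (1 - γ₁) * ((1 - γ₂) * ((1 - γ₃) * (1 - γ₄))) := by
    have h := sHub_mass_esL lo K hloK [γ₁, γ₂, γ₃, γ₄] hP01' 0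
    simp only [List.length_cons, List.length_nil, List.map_cons, List.map_nil, List.prod_cons, List.prod_nil, esL_zero, mul_one,
      Nat.mul_zero, Nat.add_zero] at h
    rw [show 4 * lo = lo * (0 + 1 + 1 + 1 + 1) by ring]
    exact h
  rw [elen] at lM l1 lmean ⊢
  set L : ℕ → ℝ := sHub lo K [γ₁, γ₂, γ₃, γ₄] with hL
  have hdef : L = lconv ((lo + K) * 3) (lo + K) L₃ SP[lo, K, γ₁] := by rw [hL, hL₃]; rfl
  have Lv : ∀ k, L k = (1 - γ₁) * (if lo ≤ k then L₃ (k - lo) else 0) + γ₁ * (if lo + K ≤ k then L₃ (k - (lo + K)) else 0) :=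
    fun k => by rw [hdef]; exact lconv_sp_apply lo K ((lo + K) * 3) L₃ γ₁ mM₃ k
  have z0 : L (4 * lo) = (1 - γ₁) * (1 - γ₂) * (1 - γ₃) * (1 - γ₄) := by rw [z0']; ring
  have z1 : L (4 * lo + K) = γ₁ * (1 - γ₂) * (1 - γ₃) * (1 - γ₄) + γ₂ * (1 - γ₁) * (1 - γ₃) * (1 - γ₄)
      + γ₃ * (1 - γ₁) * (1 - γ₂) * (1 - γ₄) + γ₄ * (1 - γ₁) * (1 - γ₂) * (1 - γ₃) := by
    rw [Lv, if_pos (by omega), if_pos (by omega), show 4 * lo + K - lo = 3 * lo + K by omega, show 4 * lo + K - (lo + K) = 3 * lo by omega,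
      vmid, vlo]; ring
  have z2 : L (4 * lo + 2 * K) = γ₁ * γ₂ * (1 - γ₃) * (1 - γ₄) + γ₁ * γ₃ * (1 - γ₂) * (1 - γ₄) + γ₁ * γ₄ * (1 - γ₂) * (1 - γ₃)
      + γ₂ * γ₃ * (1 - γ₁) * (1 - γ₄) + γ₂ * γ₄ * (1 - γ₁) * (1 - γ₃) + γ₃ * γ₄ * (1 - γ₁) * (1 - γ₂) := by
    rw [Lv, if_pos (by omega), if_pos (by omega), show 4 * lo + 2 * K - lo = 3 * lo + 2 * K by omega,
      show 4 * lo + 2 * K - (lo + K) = 3 * lo + K by omega, vtop, vmid]; ring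
  have z3 : L (4 * lo + 3 * K) = γ₂ * γ₃ * γ₄ * (1 - γ₁) + γ₁ * γ₃ * γ₄ * (1 - γ₂) + γ₁ * γ₂ * γ₄ * (1 - γ₃) + γ₁ * γ₂ * γ₃ * (1 - γ₄) := by
    rw [Lv, if_pos (by omega), if_pos (by omega), show 4 * lo + 3 * K - lo = 3 * lo + 3 * K by omega,
      show 4 * lo + 3 * K - (lo + K) = 3 * lo + 2 * K by omega, vmax, vtop]; ring
  -- support: charged atoms are `4lo + Ks`
  have hsupp : ∀ k, L k ≠ 0 → ∃ s, k = lo * 4 + K * s ∧ s ≤ 4 := by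
    intro k hk
    have := (sHub_struct lo K hloK 0 le_rfl [γ₁, γ₂, γ₃, γ₄] (fun γ hγ => ⟨(hP01 γ hγ).1, (hP01 γ hγ).2, by
      rw [zero_mul]; exact (hP01 γ hγ).1⟩)).1 k hk
    simpa using this
  clear_value L₂ L₃ L
  clear Lv Lv₃ Lv₂ hdef hdef₃ hdef₂ z0'
  intro a ha0 ha1 j' hj'
  obtain ⟨g0, gM, g1⟩ := gate_laws (4 * lo + 4 * K) L a ha0.le ha1 l0 lM l1
  have gmean : ∑ h ∈ Finset.range (4 * lo + 4 * K + 1), (h : ℝ) * gate L a h = a * (4 * (lo : ℝ) + K * (γ₁ + γ₂ + γ₃ + γ₄)) := by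
    rw [sum_mul_gate, lmean]
  have gv : ∀ h, h ≠ 0 → gate L a h = a * L h := fun h hh => by rw [gate_apply, if_neg hh, mul_zero, add_zero]
  set T : ℝ := a * (4 * (lo : ℝ) + K * (γ₁ + γ₂ + γ₃ + γ₄)) with hT
  have hax0 : 0 < a * x := mul_pos ha0 hx0
  have hax1 : a * x < 1 := by have := mul_le_mul_of_nonneg_right ha1 hx0.le; linarith
  have hT0p : 0 < 4 * (lo : ℝ) + K * (γ₁ + γ₂ + γ₃ + γ₄) := by
    have := mul_nonneg hK0.le (show 0 ≤ γ₁ + γ₂ + γ₃ + γ₄ by linarith); linarith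
  have hT0 : 0 < T := mul_pos ha0 hT0p
  have hTle : T ≤ 4 * (lo : ℝ) + K * (γ₁ + γ₂ + γ₃ + γ₄) := by
    have := mul_le_mul_of_nonneg_right ha1 hT0p.le; rw [hT]; linarith
  have hTtop : T < 4 * (lo : ℝ) + 4 * K := by
    have : (K : ℝ) * (γ₁ + γ₂ + γ₃ + γ₄) < K * 4 := mul_lt_mul_of_pos_left (by linarith) hK0
    linarith
  have hta : a * x * ((4 * lo + 4 * K : ℕ) : ℝ) ≤ T := by
    have h2 : x * (4 * (lo : ℝ) + 4 * K) ≤ 4 * (lo : ℝ) + K * (γ₁ + γ₂ + γ₃ + γ₄) := by linarith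
    have h3 := mul_le_mul_of_nonneg_left h2 ha0.le
    push_cast; rw [hT]; linarith
  have v0 : gate L a (4 * lo) = a * ((1 - γ₁) * (1 - γ₂) * (1 - γ₃) * (1 - γ₄)) := by rw [gv _ (by omega), z0]
  have v1 : gate L a (4 * lo + K) = a * (γ₁ * (1 - γ₂) * (1 - γ₃) * (1 - γ₄) + γ₂ * (1 - γ₁) * (1 - γ₃) * (1 - γ₄)
      + γ₃ * (1 - γ₁) * (1 - γ₂) * (1 - γ₄) + γ₄ * (1 - γ₁) * (1 - γ₂) * (1 - γ₃)) := by rw [gv _ (by omega), z1]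
  have v2 : gate L a (4 * lo + 2 * K) = a * (γ₁ * γ₂ * (1 - γ₃) * (1 - γ₄) + γ₁ * γ₃ * (1 - γ₂) * (1 - γ₄) + γ₁ * γ₄ * (1 - γ₂) * (1 - γ₃)
      + γ₂ * γ₃ * (1 - γ₁) * (1 - γ₄) + γ₂ * γ₄ * (1 - γ₁) * (1 - γ₃) + γ₃ * γ₄ * (1 - γ₁) * (1 - γ₂)) := by rw [gv _ (by omega), z2]
  have v3 : gate L a (4 * lo + 3 * K) = a * (γ₂ * γ₃ * γ₄ * (1 - γ₁) + γ₁ * γ₃ * γ₄ * (1 - γ₂) + γ₁ * γ₂ * γ₄ * (1 - γ₃)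
      + γ₁ * γ₂ * γ₃ * (1 - γ₄)) := by rw [gv _ (by omega), z3]
  -- a charged low is `4lo` or `4lo + K`
  have lowatom : ∀ l : ℕ, 1 ≤ l → 2 * (l : ℝ) < T → 0 < gate L a l → l = 4 * lo ∨ l = 4 * lo + K := by
    intro l hl hlT hpos
    have hLl : L l ≠ 0 := by
      intro h0; rw [gv l (by omega), h0, mul_zero] at hpos; exact lt_irrefl _ hpos
    obtain ⟨s, hs, _⟩ := hsupp l hLl
    rcases Nat.lt_or_ge s 2 with h2 | h2
    · interval_cases s
      · left; rw [hs]; ring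
      · right; rw [hs]; ring
    · exfalso
      have h1 : (K : ℝ) * 2 ≤ K * s := mul_le_mul_of_nonneg_left (by exact_mod_cast h2) hK0.le
      have hl' : (l : ℝ) = lo * 4 + K * s := by rw [hs]; push_cast; ring
      linarith
  -- the least gate: a 4-way symmetry reduction for the route lemmas
  obtain ⟨p, q, r, s, hperm, hpq, hpr, hps⟩ := exists_least_of_four γ₁ γ₂ γ₃ γ₄
  have hpK : (lo : ℝ) ≤ K * p ∧ q < 1 ∧ r < 1 ∧ s < 1 ∧ x * ((lo : ℝ) + K) ≤ lo + K * p := by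
    rcases hperm with ⟨rfl, rfl, rfl, rfl⟩ | ⟨rfl, rfl, rfl, rfl⟩ | ⟨rfl, rfl, rfl, rfl⟩ | ⟨rfl, rfl, rfl, rfl⟩
    · exact ⟨hγ₁, hγ₂1, hγ₃1, hγ₄1, hx₁⟩
    · exact ⟨hγ₂, hγ₁1, hγ₃1, hγ₄1, hx₂⟩
    · exact ⟨hγ₃, hγ₁1, hγ₂1, hγ₄1, hx₃⟩
    · exact ⟨hγ₄, hγ₁1, hγ₂1, hγ₃1, hx₄⟩
  obtain ⟨hp, hq1, hr1, hs1, hxp⟩ := hpK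
  have hTp : T = a * (4 * (lo : ℝ) + K * (p + q + r + s)) := by
    rcases hperm with ⟨rfl, rfl, rfl, rfl⟩ | ⟨rfl, rfl, rfl, rfl⟩ | ⟨rfl, rfl, rfl, rfl⟩ | ⟨rfl, rfl, rfl, rfl⟩ <;> rw [hT] <;> ring
  have w0 : gate L a (4 * lo) = a * ((1 - p) * (1 - q) * (1 - r) * (1 - s)) := by
    rcases hperm with ⟨rfl, rfl, rfl, rfl⟩ | ⟨rfl, rfl, rfl, rfl⟩ | ⟨rfl, rfl, rfl, rfl⟩ | ⟨rfl, rfl, rfl, rfl⟩ <;> rw [v0] <;> ring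
  have w1 : gate L a (4 * lo + K) = a * (p * (1 - q) * (1 - r) * (1 - s) + q * (1 - p) * (1 - r) * (1 - s)
      + r * (1 - p) * (1 - q) * (1 - s) + s * (1 - p) * (1 - q) * (1 - r)) := by
    rcases hperm with ⟨rfl, rfl, rfl, rfl⟩ | ⟨rfl, rfl, rfl, rfl⟩ | ⟨rfl, rfl, rfl, rfl⟩ | ⟨rfl, rfl, rfl, rfl⟩ <;> rw [v1] <;> ring
  have w2 : gate L a (4 * lo + 2 * K) = a * (p * q * (1 - r) * (1 - s) + p * r * (1 - q) * (1 - s) + p * s * (1 - q) * (1 - r)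
      + q * r * (1 - p) * (1 - s) + q * s * (1 - p) * (1 - r) + r * s * (1 - p) * (1 - q)) := by
    rcases hperm with ⟨rfl, rfl, rfl, rfl⟩ | ⟨rfl, rfl, rfl, rfl⟩ | ⟨rfl, rfl, rfl, rfl⟩ | ⟨rfl, rfl, rfl, rfl⟩ <;> rw [v2] <;> ring
  have w3 : gate L a (4 * lo + 3 * K) = a * (q * r * s * (1 - p) + p * r * s * (1 - q) + p * q * s * (1 - r) + p * q * r * (1 - s)) := by
    rcases hperm with ⟨rfl, rfl, rfl, rfl⟩ | ⟨rfl, rfl, rfl, rfl⟩ | ⟨rfl, rfl, rfl, rfl⟩ | ⟨rfl, rfl, rfl, rfl⟩ <;> rw [v3] <;> ring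
  clear hperm
  have c4lo : ((4 * lo : ℕ) : ℝ) = 4 * (lo : ℝ) := by push_cast; ring
  -- the budget is nonnegative
  have budnn : ∀ l ∈ Finset.range (4 * lo + 4 * K + 1), 0 ≤ (if (1 ≤ l ∧ (l : ℝ) < T) then gate L a l * (T - l) else 0) := by
    intro l _; split_ifs with hc
    · exact mul_nonneg (g0 l) (by linarith [hc.2])
    · exact le_rfl
  by_cases hT8 : 8 * (lo : ℝ) < T
  · by_cases hT82 : T ≤ 8 * (lo : ℝ) + 2 * K
    · -- ONE positive low `4lo`: whole to `t ∈ {4lo+2K, 4lo+3K}`, cost-safe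
      obtain ⟨t, ht, hTt, hcapt, hsafe⟩ := quadHub_routeOne lo K hloK hK2 hK8 (gate L a) (a * x) T a p q r s x g0 hpq hpr hps hp hq1 hr1 hs1
        hx0 hxp ha0 ha1 rfl hTp hT8 hT82 w0 w2 w3
      have httop : t ≤ 4 * lo + 4 * K := by rcases ht with rfl | rfl <;> omega
      have htmem : t ∈ Finset.range (4 * lo + 4 * K + 1) := Finset.mem_range.2 (by omega)
      have htlo : 4 * lo < t := by rcases ht with rfl | rfl <;> omega
      have colt : ∀ h : ℕ, ∑ l ∈ Finset.range (4 * lo + 4 * K + 1), freeRate (a * x) T l h * (if l = 4 * lo ∧ h = t then gate L a (4 * lo) else 0)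
          = if h = t then freeRate (a * x) T (4 * lo) t * gate L a (4 * lo) else 0 := by
        intro h
        rw [Finset.sum_eq_single_of_mem (4 * lo) (Finset.mem_range.2 (by omega)) (fun l _ hl => by simp [hl])]
        by_cases hh : h = t
        · subst hh; simp
        · simp [hh]
      refine decAt_all_of_torqueCost (a * x) (4 * lo + 4 * K) (gate L a) T
        (fun l h => if l = 4 * lo ∧ h = t then gate L a (4 * lo) else 0) hax0 hax1 g0 gM g1 gmean hT0 hta ?_ ?_ ?_ ?_ ?_ j' hj'
      · intro l h; split_ifs
        · exact g0 _
        · exact le_rfl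
      · intro l h hlh
        split_ifs at hlh with hc
        · obtain ⟨rfl, rfl⟩ := hc
          exact ⟨by omega, by rw [c4lo]; linarith, htlo, httop, hTt⟩
        · exact absurd hlh (lt_irrefl _)
      · intro l hl hlow
        by_cases hl' : l = 4 * lo
        · subst hl'
          rw [Finset.sum_eq_single_of_mem t htmem (fun h _ hh => by simp [hh])]; simp
        · rw [Finset.sum_eq_zero fun h _ => by simp [hl']]
          rcases (g0 l).eq_or_lt with h0 | hpos
          · exact h0
          · exfalso
            rcases lowatom l hl hlow hpos with h | h
            · exact hl' h
            · subst h; push_cast at hlow; linarith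
      · intro h _
        rw [colt h]
        split_ifs with hh
        · subst hh; exact hcapt
        · exact g0 h
      · rw [Finset.sum_eq_single_of_mem t htmem (fun h _ hh => by rw [colt h, if_neg hh, mul_zero, ite_self])]
        rw [colt t, if_pos rfl]
        -- cost-safe: `(t − T)·rate ≤ T − 4lo`, so the cost is within the budget term of `4lo`
        have hterm : (if T < (t : ℝ) then ((t : ℝ) - T) * (freeRate (a * x) T (4 * lo) t * gate L a (4 * lo)) else 0)
            ≤ gate L a (4 * lo) * (T - ((4 * lo : ℕ) : ℝ)) := by
          split_ifs with hc
          · have hr := freeRate_torque_le (a * x) T (4 * lo) t hax0 hax1 (by rw [c4lo]; linarith) htlo hTt hsafe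
            have := mul_le_mul_of_nonneg_right hr (g0 (4 * lo))
            linarith
          · exact mul_nonneg (g0 _) (by rw [c4lo]; linarith)
        refine hterm.trans ?_
        have hmem : 4 * lo ∈ Finset.range (4 * lo + 4 * K + 1) := Finset.mem_range.2 (by omega)
        have h1 := Finset.single_le_sum budnn hmem
        rw [if_pos ⟨by omega, by rw [c4lo]; linarith⟩] at h1
        exact h1
    · -- TWO positive lows `4lo → 4lo+3K`, `4lo+K → 4lo+2K`
      push Not at hT82
      obtain ⟨hcap0, hcap1⟩ := quadHub_routeTwo lo K hloK hK2 hK8 (gate L a) (a * x) T a p q r s x g0 hpq hpr hps hp hq1 hr1 hs1 hx0 hxp ha0 ha1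
        rfl hTp hT82 w0 w1 w2 w3
      set M : ℕ := 4 * lo + 4 * K with hM
      set f : ℕ → ℕ → ℝ := fun l h => if (l = 4 * lo ∧ h = 4 * lo + 3 * K) ∨ (l = 4 * lo + K ∧ h = 4 * lo + 2 * K) then gate L a l else 0 with hf
      have hne1 : 4 * lo + 3 * K ≠ 4 * lo + 2 * K := by omega
      have f0v : ∀ h, f (4 * lo) h = if h = 4 * lo + 3 * K then gate L a (4 * lo) else 0 := by
        intro h; rw [hf]; dsimp only
        by_cases hh : h = 4 * lo + 3 * K
        · rw [if_pos (Or.inl ⟨rfl, hh⟩), if_pos hh]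
        · rw [if_neg (by rintro (⟨_, h1⟩ | ⟨h2, _⟩) <;> omega), if_neg hh]
      have f1v : ∀ h, f (4 * lo + K) h = if h = 4 * lo + 2 * K then gate L a (4 * lo + K) else 0 := by
        intro h; rw [hf]; dsimp only
        by_cases hh : h = 4 * lo + 2 * K
        · rw [if_pos (Or.inr ⟨rfl, hh⟩), if_pos hh]
        · rw [if_neg (by rintro (⟨h1, _⟩ | ⟨_, h2⟩) <;> omega), if_neg hh]
      have fne : ∀ l h, l ≠ 4 * lo → l ≠ 4 * lo + K → f l h = 0 := by
        intro l h h1 h2; rw [hf]; dsimp only; rw [if_neg (by rintro (⟨h3, _⟩ | ⟨h4, _⟩) <;> omega)]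
      have col : ∀ h, ∑ l ∈ Finset.range (M + 1), freeRate (a * x) T l h * f l h
          = freeRate (a * x) T (4 * lo) h * f (4 * lo) h + freeRate (a * x) T (4 * lo + K) h * f (4 * lo + K) h := by
        intro h
        rw [Finset.sum_eq_add_of_mem (4 * lo) (4 * lo + K) (Finset.mem_range.2 (by omega)) (Finset.mem_range.2 (by omega)) (by omega)
          (fun l _ hl => by rw [fne l h hl.1 hl.2, mul_zero])]
      have cMR : ((M : ℕ) : ℝ) = 4 * (lo : ℝ) + 4 * K := by rw [hM]; push_cast; ring
      refine decAt_all_of_torqueCost (a * x) M (gate L a) T f hax0 hax1 g0 gM g1 gmean hT0 hta ?_ ?_ ?_ ?_ ?_ j' hj'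
      · intro l h; rw [hf]; dsimp only; split_ifs
        · exact g0 _
        · exact le_rfl
      · intro l h hlh
        rw [hf] at hlh; dsimp only at hlh
        split_ifs at hlh with hc
        · rcases hc with ⟨rfl, rfl⟩ | ⟨rfl, rfl⟩
          · exact ⟨by omega, by push_cast; linarith, by omega, by omega, by push_cast; linarith⟩
          · exact ⟨by omega, by push_cast; linarith, by omega, by omega, by push_cast; linarith⟩
        · exact absurd hlh (lt_irrefl _)
      · intro l hl hlow
        by_cases hl0 : l = 4 * lo
        · subst hl0
          rw [Finset.sum_congr rfl fun h _ => f0v h, Finset.sum_ite_eq' (Finset.range (M + 1)), if_pos (Finset.mem_range.2 (by omega))]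
        by_cases hl1 : l = 4 * lo + K
        · subst hl1
          rw [Finset.sum_congr rfl fun h _ => f1v h, Finset.sum_ite_eq' (Finset.range (M + 1)), if_pos (Finset.mem_range.2 (by omega))]
        rw [Finset.sum_eq_zero fun h _ => fne l h hl0 hl1]
        rcases (g0 l).eq_or_lt with h0 | hpos
        · exact h0
        · rcases lowatom l hl hlow hpos with h | h
          · exact absurd h hl0
          · exact absurd h hl1
      · intro h _
        rw [col h, f0v h, f1v h]
        by_cases hh3 : h = 4 * lo + 3 * K
        · subst hh3; rw [if_pos rfl, if_neg hne1, mul_zero, add_zero]; exact hcap0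
        by_cases hh2 : h = 4 * lo + 2 * K
        · subst hh2; rw [if_neg (Ne.symm hne1), if_pos rfl, mul_zero, zero_add]; exact hcap1
        rw [if_neg hh3, if_neg hh2, mul_zero, mul_zero, add_zero]; exact g0 h
      · -- both targets are below `T`: no torque cost
        have hzero : ∀ h ∈ Finset.range (M + 1),
            (if T < (h : ℝ) then ((h : ℝ) - T) * ∑ l ∈ Finset.range (M + 1), freeRate (a * x) T l h * f l h else 0) = 0 := by
          intro h _
          by_cases hTh : T < (h : ℝ)
          · rw [if_pos hTh, col h, f0v h, f1v h]
            have hh3 : h ≠ 4 * lo + 3 * K := by rintro rfl; push_cast at hTh; linarith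
            have hh2 : h ≠ 4 * lo + 2 * K := by rintro rfl; push_cast at hTh; linarith
            rw [if_neg hh3, if_neg hh2]; ring
          · rw [if_neg hTh]
        rw [Finset.sum_congr rfl hzero, Finset.sum_const_zero]
        exact Finset.sum_nonneg budnn
  · -- no positive low atom
    refine decAt_all_of_lowCeiling (a * x) (4 * lo + 4 * K) (gate L a) T hax0 hax1 g0 gM g1 gmean hT0 hta ?_ j' hj'
    intro l hl hlow hpos
    exfalso
    rcases lowatom l hl hlow hpos with h | h <;> subst h <;> push_cast at hlow <;> linarith

/-- **THE WIDTH-4 HUB OF EVERY SHAPE `lo < K ≤ 4lo` IS SDEC** at every gate `γᵢ ≥ lo/K` and every affordable floor (gen 32's `sdec_sHub_wide` for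
`K ≤ 2lo`, `sdec_sHub_four_long` for `2lo < K ≤ 4lo`). [this work] -/
theorem sdec_sHub_four_upTo4 (lo K : ℕ) (hloK : lo < K) (hK8 : K ≤ 4 * lo) {x : ℝ} (hx0 : 0 < x) (P : List ℝ) (hP4 : P.length = 4)
    (hP : ∀ γ ∈ P, (lo : ℝ) ≤ K * γ ∧ γ < 1 ∧ x * ((lo : ℝ) + K) ≤ lo + K * γ) :
    SDEC x ((lo + K) * P.length) (sHub lo K P) := by
  rcases le_or_gt K (2 * lo) with h | h
  · exact sdec_sHub_wide lo K hloK h hx0 P (by rw [hP4]) hP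
  · exact sdec_sHub_four_long lo K hloK h hK8 hx0 P hP4 hP

/-- **THE HUBS OF WIDTHS 2, 3 AND 4 OF EVERY SHAPE `lo < K ≤ 4lo` ARE SDEC** at every gate `γᵢ ≥ lo/K` and every affordable floor
(`sdec_sHub_twoThree_upTo4`, `sdec_sHub_four_upTo4`). [this work] -/
theorem sdec_sHub_upToFour_upTo4 (lo K : ℕ) (hloK : lo < K) (hK8 : K ≤ 4 * lo) {x : ℝ} (hx0 : 0 < x) (P : List ℝ)
    (hP24 : 2 ≤ P.length ∧ P.length ≤ 4) (hP : ∀ γ ∈ P, (lo : ℝ) ≤ K * γ ∧ γ < 1 ∧ x * ((lo : ℝ) + K) ≤ lo + K * γ) :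
    SDEC x ((lo + K) * P.length) (sHub lo K P) := by
  rcases hP24 with ⟨h2, h4⟩
  rcases Nat.lt_or_ge P.length 4 with h | h
  · exact sdec_sHub_twoThree_upTo4 lo K hloK hK8 hx0 P (by omega) hP
  · exact sdec_sHub_four_upTo4 lo K hloK hK8 hx0 P (by omega) hP

end LawDec
end Quant
end Summit.CriticalPhenomena.PercolationContinuityZ3.Theorems
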